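import Mathlib
import Literature.Analysis.FluidPDE.VectorCalculus
import Literature.Analysis.FluidPDE.SelfSimilarEulerProfile
import Literature.Analysis.FluidPDE.SelfSimilarEulerProfileVorticity
import Literature.Analysis.FluidPDE.SelfSimilarEulerVorticityCompactSupport

/-!
# R52 plate t55-E5: the ENSTROPHY-WEIGHTED FLUX LAW (nsreg-p2 ROUND-52 «PROVENANCE» §E addendum; text and proof VERBATIM from
# `r52/Sketch52E.lean` 71b4a3bde833b3de, nsreg-p2 g42 — authorship of the proof: nsreg-p2 g42; seat ns-ezl-w2 g6,
# `--supports stmt-NavierStokesRegularity-19832 --as helper`)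

(δ) VORTICAL PROVENANCE: vorticity is frozen into the wind `W = γ(y−c) + U` up to the exact factor `DΩ[W] = DU·Ω − Ω` (CIV (3.4)), so every
`C¹` weight `ψ(‖Ω‖²)` obeys `div(ψ(‖Ω‖²)·W) = 3γψ(‖Ω‖²) + 2ψ′(‖Ω‖²)(⟪Ω, DU Ω⟫ − ‖Ω‖²)` — `divergence_enstrophyWeight_transport`, every `γ`,
every centre.  (The typed `SmallMomentLaw` of the addendum is a statement for R53 and is NOT landed here.)

HONEST FRAMING: an exact class-free identity for hypothetical profiles (ROUND-52 instrument); nothing about the crux E (19832 OPEN) or NS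
regularity. [cite: ConstantinIgnatovaVicol2026Putative, §3.1.1 eq. (3.4)] [folklore]
-/

noncomputable section

set_option linter.dupNamespace false

open MeasureTheory Set Filter Topology Metric Function TopologicalSpace
open scoped ENNReal NNReal RealInnerProductSpace

namespace Summit.NavierStokesRegularity.NavierStokesRegularity.Theorems.PowerGaugeEulerLiouville

open Literature.Analysis Literature.Analysis.FluidPDE InnerProductSpace

namespace ClassicalProfile

/-- **(E5) THE ENSTROPHY-WEIGHTED FLUX LAW** (every `γ`, every centre, every `C¹` weight of `‖Ω‖²`): for a `C²` velocity-form profile,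
`div(ψ(‖Ω‖²)·W)(y) = 3γ·ψ(‖Ω(y)‖²) + 2·ψ′(‖Ω(y)‖²)·(⟪Ω(y), DU(y)Ω(y)⟫ − ‖Ω(y)‖²)`, `Ω = curl U`, `W = γ(y−c) + U`.
Ingredients: the bridge (3.3) ⇒ (3.4) `IsSelfSimilarEulerProfile.isSelfSimilarEulerVorticityProfile`, `fderiv_curl_transport`
(`DΩ[W] = DU·Ω − Ω`), `HasFDerivAt.norm_sq`, `div W = 3γ`, `tr(ℓ ⊗ W) = ℓ(W)`. [nsreg-p2 R52 §E; cite: ConstantinIgnatovaVicol2026Putative, §3.1.1 eq. (3.4)] -/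
theorem divergence_enstrophyWeight_transport {γ : ℝ} {c : (EuclideanSpace ℝ (Fin 3))} {U : (EuclideanSpace ℝ (Fin 3)) → (EuclideanSpace ℝ (Fin 3))} {P : (EuclideanSpace ℝ (Fin 3)) → ℝ}
    (hprof : IsSelfSimilarEulerProfile γ c U P) {ψ : ℝ → ℝ} (hψ : ContDiff ℝ 1 ψ) (y : (EuclideanSpace ℝ (Fin 3))) :
    VectorCalculus.divergence (fun x => ψ (‖curl U x‖ ^ 2) • selfSimilarTransport γ c U x) y =
      3 * γ * ψ (‖curl U y‖ ^ 2) +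
        2 * deriv ψ (‖curl U y‖ ^ 2) * (⟪curl U y, fderiv ℝ U y (curl U y)⟫ - ‖curl U y‖ ^ 2) := by
  have hvort : IsSelfSimilarEulerVorticityProfile γ c U := hprof.isSelfSimilarEulerVorticityProfile
  have hUd : Differentiable ℝ U := hprof.differentiable_velocity
  have hΩd : Differentiable ℝ (curl U) := hvort.differentiable_curl
  -- `DW(y) = γ·id + DU(y)`
  have hW : HasFDerivAt (selfSimilarTransport γ c U) (γ • ContinuousLinearMap.id ℝ (EuclideanSpace ℝ (Fin 3)) + fderiv ℝ U y) y :=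
    hasFDerivAt_selfSimilarTransport hUd y
  -- the weight `x ↦ ψ(‖Ω x‖²)` and its derivative
  have hN : HasFDerivAt (fun x => ‖curl U x‖ ^ 2) ((2 : ℕ) • (innerSL ℝ (curl U y)).comp (fderiv ℝ (curl U) y)) y :=
    (hΩd y).hasFDerivAt.norm_sq
  have hψd : HasDerivAt ψ (deriv ψ (‖curl U y‖ ^ 2)) (‖curl U y‖ ^ 2) :=
    ((hψ.differentiable one_ne_zero) _).hasDerivAt
  have hf : HasFDerivAt (fun x => ψ (‖curl U x‖ ^ 2))
      (deriv ψ (‖curl U y‖ ^ 2) • ((2 : ℕ) • (innerSL ℝ (curl U y)).comp (fderiv ℝ (curl U) y))) y :=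
    hψd.comp_hasFDerivAt y hN
  have hprod := hf.smul hW
  -- traces
  have htrU : LinearMap.trace ℝ (EuclideanSpace ℝ (Fin 3)) ((fderiv ℝ U y : (EuclideanSpace ℝ (Fin 3)) →L[ℝ] (EuclideanSpace ℝ (Fin 3))) : (EuclideanSpace ℝ (Fin 3)) →ₗ[ℝ] (EuclideanSpace ℝ (Fin 3))) = 0 := hprof.divFree y
  have htr : LinearMap.trace ℝ (EuclideanSpace ℝ (Fin 3)) ((γ • ContinuousLinearMap.id ℝ (EuclideanSpace ℝ (Fin 3)) + fderiv ℝ U y : (EuclideanSpace ℝ (Fin 3)) →L[ℝ] (EuclideanSpace ℝ (Fin 3))) : (EuclideanSpace ℝ (Fin 3)) →ₗ[ℝ] (EuclideanSpace ℝ (Fin 3))) = 3 * γ := by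
    rw [ContinuousLinearMap.toLinearMap_add, ContinuousLinearMap.toLinearMap_smul, map_add, map_smul, htrU, add_zero,
      ContinuousLinearMap.coe_id, LinearMap.trace_id, finrank_euclideanSpace_fin]
    simp [mul_comm]
  have hfun : (fun x => ψ (‖curl U x‖ ^ 2) • selfSimilarTransport γ c U x) =
      ((fun x => ψ (‖curl U x‖ ^ 2)) • selfSimilarTransport γ c U) := rfl
  unfold VectorCalculus.divergence
  rw [hfun, hprod.fderiv, ContinuousLinearMap.toLinearMap_add, map_add, ContinuousLinearMap.toLinearMap_smul, map_smul, htr]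
  -- the rank-one term: `tr (ℓ ⊗ W(y)) = ℓ (W y)` with `ℓ = ψ′ · 2⟪Ω, DΩ(·)⟫`
  set ℓ : (EuclideanSpace ℝ (Fin 3)) →L[ℝ] ℝ := deriv ψ (‖curl U y‖ ^ 2) • ((2 : ℕ) • (innerSL ℝ (curl U y)).comp (fderiv ℝ (curl U) y)) with hℓ
  have hsr : ((ℓ.smulRight (selfSimilarTransport γ c U y) : (EuclideanSpace ℝ (Fin 3)) →L[ℝ] (EuclideanSpace ℝ (Fin 3))) : (EuclideanSpace ℝ (Fin 3)) →ₗ[ℝ] (EuclideanSpace ℝ (Fin 3))) =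
      ((ℓ : (EuclideanSpace ℝ (Fin 3)) →L[ℝ] ℝ) : (EuclideanSpace ℝ (Fin 3)) →ₗ[ℝ] ℝ).smulRight (selfSimilarTransport γ c U y) := rfl
  rw [hsr, LinearMap.trace_smulRight, ContinuousLinearMap.coe_coe, hℓ, _root_.smul_apply, _root_.smul_apply,
    ContinuousLinearMap.comp_apply, innerSL_apply_apply, hvort.fderiv_curl_transport y, inner_sub_right, real_inner_self_eq_norm_sq,
    smul_eq_mul, smul_eq_mul, nsmul_eq_mul]
  push_cast
  ring


end ClassicalProfile

end Summit.NavierStokesRegularity.NavierStokesRegularity.Theorems.PowerGaugeEulerLiouville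

end
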